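import Literature.Topology.FourManifolds.SurfaceGroupNielsenCoreReduction
import Literature.Topology.FourManifolds.SurfaceGroupNielsenBlockLemma
import Literature.Topology.FourManifolds.SurfaceGroupNielsenDegree
import Literature.Topology.FourManifolds.SurfaceGroupCayleyCounting
import HarnessLib

/-!
# Nielsen's theorem: what is left after the landed pillars (and the `RelatorKilled` proviso)

Topic `Literature/Topology/FourManifolds`.  Three of Zieschang's five pillars for Nielsen's
lifting theorem (`nielsen_surfaceGroup_mulEquiv_lift`, ZVC LNM 835 Thm. 5.6.1) are theorems of
the tree — the block lemma (A3, `blockLemma_holds`), the mapping degree (C1,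
`degreeOfAut_holds`) and the planar counting (B, `simpleCircuitRotation_holds`).

**Proviso.** The CORE pillar `HomotopicSimple g` and the no-double-point property
`NoDoublePoint g` of `SurfaceGroupNielsenSetup.lean` / `SurfaceGroupNielsenCoreFrame.lean`
quantify over ALL assignments `φ` of the symbols; but a simple circuit is a CLOSED path, so the
conclusion can only hold when `φ` kills the relator, `φ̂(r_g) = 1` (`RelatorKilled φ`) — which
is the case for the assignments `φ = α ∘ of` the assembly uses.  The unrestricted statements are
not claimed; this file introduces the restricted ones, `HomotopicSimpleK g` and
`NoDoublePointK g`, re-proves the assembly with them (`liftable_of_pillarsK`,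
`nielsen_of_pillarsK`, verbatim the proofs of `SurfaceGroupNielsenAssembly.lean`), the frame
reduction (`homotopicSimpleK_of_noDoublePointK`), and records the resulting status:
**Nielsen's theorem follows from `NoDoublePointK g` and `RelatorEndIsAut g` (ZVC Cor. 5.2.13)
for `g ≥ 2`** (`nielsen_of_noDoublePointK_of_relatorEndIsAut`).

## References

* H. Zieschang, E. Vogt, H.-D. Coldewey, *Surfaces and Planar Discontinuous Groups*, LNM 835
  (1980), Thm. 5.3.2, Cor. 5.3.5, Thm. 5.6.1. [ZieschangVogtColdewey1980]
-/

noncomputable section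

namespace Literature.Topology.FourManifolds

open Literature.GroupTheory.CombinatorialGroupTheory List

namespace SurfaceGroup

variable {g : ℕ}

/-- The assignment `φ` **kills the relator**: `φ̂ (r_g) = 1`, i.e. `φ` extends to an
endomorphism of `S_g`. [folklore] -/
def RelatorKilled (φ : surfaceGen g → SurfaceGroup g) : Prop :=
  FreeGroup.lift φ (surfaceRelator g) = 1

/-- Automorphic assignments kill the relator. [folklore] -/
theorem relatorKilled_aut (α : SurfaceGroup g ≃* SurfaceGroup g) :
    RelatorKilled (fun i : surfaceGen g => α (PresentedGroup.of i)) := by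
  rw [RelatorKilled, lift_aut_assignment]
  simp

/-- **(CORE, restricted) Homotopic shortening** for assignments killing the relator
(ZVC Thm. 5.2.6 + Thm. 5.3.2 + Cor. 5.3.5). [cite: ZieschangVogtColdewey1980, Thm. 5.3.2 and Cor. 5.3.5] -/
def HomotopicSimpleK (g : ℕ) : Prop :=
  ∀ (φ : surfaceGen g → SurfaceGroup g), RelatorKilled φ → Indecomposable φ → MarkedNontrivial φ →
    ∀ X : surfaceGen g → FreeGroup (surfaceGen g), (∀ i, proj g (X i) = φ i) →
    ∃ X' : surfaceGen g → FreeGroup (surfaceGen g), (∀ i, proj g (X' i) = φ i) ∧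
      IsSimpleCircuit (g := g)
        (FreeGroup.reduceCyclically (FreeGroup.toWord (FreeGroup.lift X' (surfaceRelator g))))

/-- **No double point (restricted)**: for an assignment killing the relator which is
indecomposable and marked non-trivial, the cyclically reduced value of a potential-minimal
configuration is a simple circuit. [cite: ZieschangVogtColdewey1980, Thm. 5.3.2, Cor. 5.3.5] -/
def NoDoublePointK (g : ℕ) : Prop :=
  ∀ (φ : surfaceGen g → SurfaceGroup g), RelatorKilled φ → Indecomposable φ → MarkedNontrivial φ →
    ∀ κ : Config φ, κ.IsMin →
      IsSimpleCircuit (g := g) (FreeGroup.reduceCyclically (FreeGroup.toWord κ.value))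

/-- **Restricted CORE from restricted no-double-point** (minimise the potential, pull back,
rotate). [cite: ZieschangVogtColdewey1980, Thm. 5.3.2 and Cor. 5.3.5] -/
theorem homotopicSimpleK_of_noDoublePointK (hN : NoDoublePointK g) : HomotopicSimpleK g := by
  intro φ hK hI hM X hX
  obtain ⟨κ, hκ⟩ := Config.exists_isMin (φ := φ) X hX
  have hsimple := hN φ hK hI hM κ hκ
  refine ⟨κ.pullback, κ.proj_pullback, ?_⟩
  obtain ⟨d, hd⟩ := κ.lift_pullback_surfaceRelator
  obtain ⟨k, hk⟩ := cyclicReductionOfConj_holds g κ.value d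
  rw [hd, hk]
  exact simpleCircuitRotate_holds g _ k hsimple

/-- **Nielsen's theorem for `S_g` from the pillars, CORE in restricted form** (the proof of
`liftable_of_pillars` verbatim; the assignment `α ∘ of` kills the relator).
[cite: ZieschangVogtColdewey1980, Thm. 5.6.1] -/
theorem liftable_of_pillarsK (hg : 1 ≤ g) (hA : BlockLemma g) (hC : HomotopicSimpleK g)
    (hB : SimpleCircuitRotation g) (hD : DegreeOfAut g) (hE : RelatorEndIsAut g)
    (α : SurfaceGroup g ≃* SurfaceGroup g) : Liftable α := by
  -- the automorphic assignment and a lift of it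
  set φ : surfaceGen g → SurfaceGroup g := fun i => α (PresentedGroup.of i) with hφ
  obtain ⟨X, hX⟩ : ∃ X : surfaceGen g → FreeGroup (surfaceGen g), ∀ i, proj g (X i) = φ i :=
    ⟨fun i => (PresentedGroup.mk_surjective _ (φ i)).choose,
      fun i => (PresentedGroup.mk_surjective _ (φ i)).choose_spec⟩
  -- CORE: a homotopic lift with a simple boundary circuit
  obtain ⟨X', hX', hsimple⟩ :=
    hC φ (relatorKilled_aut α) (indecomposable_of_blockLemma hA α) (markedNontrivial_aut α) X hX
  set Φ : FreeGroup (surfaceGen g) →* FreeGroup (surfaceGen g) := FreeGroup.lift X' with hΦdef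
  have hΦ : ∀ x, proj g (Φ x) = α (proj g x) := by
    intro x
    have e : (proj g).comp Φ = α.toMonoidHom.comp (proj g) := by
      refine FreeGroup.ext_hom _ _ fun i => ?_
      simp only [MonoidHom.coe_comp, Function.comp_apply, hΦdef, FreeGroup.lift_apply_of, hX' i, hφ,
        MulEquiv.coe_toMonoidHom]
      rfl
    exact DFunLike.congr_fun e x
  set V := Φ (surfaceRelator g) with hVdef
  have hVker : V ∈ (proj g).ker := by
    rw [MonoidHom.mem_ker, hVdef, hΦ, mk_surfaceRelator, map_one]
  -- the cyclically reduced boundary word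
  set w := FreeGroup.reduceCyclically (FreeGroup.toWord V) with hwdef
  obtain ⟨d, hd⟩ := exists_eq_conj_mk_reduceCyclically V
  rw [← hwdef] at hd
  have hwker : FreeGroup.mk w ∈ (proj g).ker := by
    have : FreeGroup.mk w = d⁻¹ * V * d⁻¹⁻¹ := by rw [hd]; group
    rw [this]
    exact (MonoidHom.normal_ker (proj g)).conj_mem _ hVker _
  obtain ⟨L, hL⟩ := exists_conjProd_of_mem_ker hwker
  -- degree ±1
  have hdegw : relatorDegree g (FreeGroup.mk w) = g * signSum L := by rw [hL, relatorDegree_conjProd]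
  have hdegV : relatorDegree g V = relatorDegree g (FreeGroup.mk w) := by
    rw [hd, relatorDegree_conj_of_mem_ker _ hwker]
  have hsign : signSum L = 1 ∨ signSum L = -1 := by
    have hg0 : (g : ℤ) ≠ 0 := by exact_mod_cast (Nat.one_le_iff_ne_zero.1 hg)
    rcases hD α Φ hΦ with h | h
    · left
      rw [← hVdef, hdegV, hdegw] at h
      have : (g : ℤ) * signSum L = g * 1 := by rw [h, mul_one]
      exact mul_left_cancel₀ hg0 this
    · right
      rw [← hVdef, hdegV, hdegw] at h
      have : (g : ℤ) * signSum L = g * (-1) := by rw [h, mul_neg_one]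
      exact mul_left_cancel₀ hg0 this
  -- planar counting: the boundary word is the relator up to rotation and inversion
  obtain ⟨k, hk⟩ := hB w L hsimple hL hsign
  obtain ⟨e, ε, hε, he⟩ := exists_conj_of_rotate hk
  have hV : Φ (surfaceRelator g) = (d * e) * surfaceRelator g ^ ε * (d * e)⁻¹ := by
    rw [← hVdef, hd, he]; group
  -- Zieschang–Nielsen: the endomorphism is an automorphism
  have hbij := hE Φ (d * e) ε hε hV
  refine ⟨MulEquiv.ofBijective Φ hbij, d * e, ε, hε, ?_, fun x => ?_⟩
  · simpa using hV
  · exact hΦ x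

/-- **Nielsen's theorem from the pillars (CORE restricted) in every genus `≥ 2`** (genus `≤ 1`
unconditional). [cite: ZieschangVogtColdewey1980, Thm. 5.6.1] [cite: Nielsen1927] -/
theorem nielsen_of_pillarsK
    (H : ∀ g : ℕ, 2 ≤ g → BlockLemma g ∧ HomotopicSimpleK g ∧ SimpleCircuitRotation g ∧
      DegreeOfAut g ∧ RelatorEndIsAut g) :
    nielsen_surfaceGroup_mulEquiv_lift := by
  intro g α
  by_cases hg : g ≤ 1
  · exact nielsen_surfaceGroup_mulEquiv_lift_of_le_one g hg α
  · obtain ⟨hA, hC, hB, hD, hE⟩ := H g (by omega)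
    exact liftable_of_pillarsK (by omega) hA hC hB hD hE α

/-- **Status: Nielsen's theorem from the two remaining pillars**, `NoDoublePointK` (ZVC
5.3.2/5.3.5 in minimal-counterexample form) and `RelatorEndIsAut` (ZVC Cor. 5.2.13), the block
lemma, the degree and the planar counting being theorems of the tree.
[cite: ZieschangVogtColdewey1980, Thm. 5.6.1] -/
theorem nielsen_of_noDoublePointK_of_relatorEndIsAut
    (hN : ∀ g : ℕ, 2 ≤ g → NoDoublePointK g) (hE : ∀ g : ℕ, 2 ≤ g → RelatorEndIsAut g) :
    nielsen_surfaceGroup_mulEquiv_lift :=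
  nielsen_of_pillarsK fun g hg =>
    ⟨blockLemma_holds g, homotopicSimpleK_of_noDoublePointK (hN g hg),
      simpleCircuitRotation_holds (by omega), degreeOfAut_holds g, hE g hg⟩

end SurfaceGroup

end Literature.Topology.FourManifolds

end
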